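import Literature.Computability.AlgebraicComplexity.MS2001ClassVarieties
import HarnessLib

/-!
# GCT I, Thms. 4.6 / 4.7 (all algebraically closed fields) from Kempf's parabolic criterion — the end glue

Theorem-only companion of `MS2001ClassVarieties.lean` (named facts `MS2001_thm_4_6`,
`MS2001_thm_4_7`: `det_m`, `per_n` are polystable over EVERY algebraically closed field) and of the
cell `val-lit` programme "Kempf's optimal parabolic for `SL_σ` over any algebraically closed field"
(files `HilbertMumfordSLForms.lean`, `KempfTorusWeights.lean`, `KempfNumericalFunction.lean`,
`KempfOptimalParabolicSL.lean`; analysis/linear-algebra bricks `MaxMinLinearOnSphere.lean`,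
`BruhatTwoWeights.lean`).

Mulmuley–Sohoni's printed proof (GCT I, AV p.15): "the stabilizer `R` of `det(Y)` … is not contained
in any proper parabolic subgroup of `G` (its representation on `m × m` matrices, eq. (4), is
irreducible), so Kempf's criterion [Kempf 1978, Cor. 4.4–4.5] applies" — Kempf: if the `SL`-orbit of
`v` is NOT closed, the canonical destabilising flag is a proper nonzero subspace stable under the
stabiliser of `v`. This file is the LAST STEP, stated against the programme's TARGET SHAPE
(NOTE-t14g7-kempf-anychar-sizing.md §TARGET):

  `KempfParabolic v := ¬ IsPolystable v → ∃ W : Submodule K (σ → K), W ≠ ⊥ ∧ W ≠ ⊤ ∧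
     ∀ γ : SL σ K, linSubst ↑γ v = v → ∀ x ∈ W, (↑γ).mulVec x ∈ W`

(spelled out as a hypothesis, no definition): from it and the tree's irreducibility theorems
`MS2001_detStabilizer_irreducible` (any field) / `MS2001_perStabilizer_irreducible` (infinite
fields) follow `IsPolystable (detPoly (Fin m) K)` / `IsPolystable (perPoly (Fin n) K)`, and from the
criterion for all algebraically closed `K` the named facts `MS2001_thm_4_6` / `MS2001_thm_4_7`.
Nothing is discharged HERE: the criterion is the hypothesis; the discharge is the programme's
file E. HONEST FRAMING: classical GIT bookkeeping; nothing here bears on VP versus VNP.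

## References

* [MulmuleySohoniSIAM2001] K. Mulmuley, M. Sohoni, *GCT I*, SIAM J. Comput. 31 (2001), Thms. 4.6,
  4.7 (AV p.15) = journal Thms. 4.1, 4.2.
* [Kempf1978] G. R. Kempf, *Instability in invariant theory*, Ann. of Math. 108 (1978), Cor. 4.4–4.5.
-/

noncomputable section

namespace Literature.Computability.AlgebraicComplexity

open MvPolynomial

section Glue

variable {K : Type} [Field K]

/-- **`det_m` is polystable over `K` as soon as Kempf's parabolic criterion holds for `det_m`**
(MS 2001, proof of Thm. 4.6: the `SL`-stabiliser of `det_m` acts irreducibly on `M_m`,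
`MS2001_detStabilizer_irreducible`, so it preserves no proper nonzero subspace). Any field.
[cite: MulmuleySohoniSIAM2001, proof of Thm. 4.6 (AV p.15)] -/
theorem isPolystable_detPoly_of_parabolic (m : ℕ)
    (hKempf : ¬ IsPolystable (detPoly (Fin m) K) →
      ∃ W : Submodule K (Fin m × Fin m → K), W ≠ ⊥ ∧ W ≠ ⊤ ∧
        ∀ γ : Matrix.SpecialLinearGroup (Fin m × Fin m) K,
          linSubst (Fin m × Fin m) K (γ : Matrix (Fin m × Fin m) (Fin m × Fin m) K)
            (detPoly (Fin m) K) = detPoly (Fin m) K →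
          ∀ x ∈ W, (γ : Matrix (Fin m × Fin m) (Fin m × Fin m) K).mulVec x ∈ W) :
    IsPolystable (detPoly (Fin m) K) := by
  by_contra h
  obtain ⟨W, hbot, htop, hW⟩ := hKempf h
  have hW' : ∀ γ ∈ slSubgroup (Fin m × Fin m) K ⊓ linStabilizer (detPoly (Fin m) K),
      ∀ w ∈ W, (γ : Matrix (Fin m × Fin m) (Fin m × Fin m) K).mulVec w ∈ W := by
    intro γ hγ w hw
    obtain ⟨hsl, hstab⟩ := Subgroup.mem_inf.mp hγ
    rw [mem_slSubgroup_iff] at hsl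
    rw [mem_linStabilizer, linSubstRep_apply] at hstab
    exact hW ⟨(γ : Matrix (Fin m × Fin m) (Fin m × Fin m) K), hsl⟩ hstab w hw
  rcases MS2001_detStabilizer_irreducible W hW' with h0 | h1
  · exact hbot h0
  · exact htop h1

/-- **`per_n` is polystable over an infinite field `K` as soon as Kempf's parabolic criterion holds
for `per_n`** (MS 2001, proof of Thm. 4.7: the `SL`-stabiliser of `per_n` acts irreducibly on `M_n`,
`MS2001_perStabilizer_irreducible`). [cite: MulmuleySohoniSIAM2001, proof of Thm. 4.7 (AV p.15)] -/
theorem isPolystable_perPoly_of_parabolic [Infinite K] (n : ℕ)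
    (hKempf : ¬ IsPolystable (perPoly (Fin n) K) →
      ∃ W : Submodule K (Fin n × Fin n → K), W ≠ ⊥ ∧ W ≠ ⊤ ∧
        ∀ γ : Matrix.SpecialLinearGroup (Fin n × Fin n) K,
          linSubst (Fin n × Fin n) K (γ : Matrix (Fin n × Fin n) (Fin n × Fin n) K)
            (perPoly (Fin n) K) = perPoly (Fin n) K →
          ∀ x ∈ W, (γ : Matrix (Fin n × Fin n) (Fin n × Fin n) K).mulVec x ∈ W) :
    IsPolystable (perPoly (Fin n) K) := by
  by_contra h
  obtain ⟨W, hbot, htop, hW⟩ := hKempf h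
  have hW' : ∀ γ ∈ slSubgroup (Fin n × Fin n) K ⊓ linStabilizer (perPoly (Fin n) K),
      ∀ w ∈ W, (γ : Matrix (Fin n × Fin n) (Fin n × Fin n) K).mulVec w ∈ W := by
    intro γ hγ w hw
    obtain ⟨hsl, hstab⟩ := Subgroup.mem_inf.mp hγ
    rw [mem_slSubgroup_iff] at hsl
    rw [mem_linStabilizer, linSubstRep_apply] at hstab
    exact hW ⟨(γ : Matrix (Fin n × Fin n) (Fin n × Fin n) K), hsl⟩ hstab w hw
  rcases MS2001_perStabilizer_irreducible W hW' with h0 | h1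
  · exact hbot h0
  · exact htop h1

end Glue

/-- **GCT I, Thm. 4.6 for every algebraically closed field, from Kempf's parabolic criterion**
for homogeneous forms over algebraically closed fields (the programme's TARGET, quantified over all
such fields and all finite variable types `Fin N × Fin N`). [cite: MulmuleySohoniSIAM2001, Thm. 4.6 (AV p.15)] -/
theorem MS2001_thm_4_6_of_parabolic
    (hKempf : ∀ (K : Type) [Field K] [IsAlgClosed K] (N D : ℕ) (v : MvPolynomial (Fin N × Fin N) K),
      v.IsHomogeneous D → ¬ IsPolystable v →
      ∃ W : Submodule K (Fin N × Fin N → K), W ≠ ⊥ ∧ W ≠ ⊤ ∧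
        ∀ γ : Matrix.SpecialLinearGroup (Fin N × Fin N) K,
          linSubst (Fin N × Fin N) K (γ : Matrix (Fin N × Fin N) (Fin N × Fin N) K) v = v →
          ∀ x ∈ W, (γ : Matrix (Fin N × Fin N) (Fin N × Fin N) K).mulVec x ∈ W) :
    MS2001_thm_4_6 := by
  intro K _ _ m
  exact isPolystable_detPoly_of_parabolic m
    (hKempf K m (Fintype.card (Fin m)) (detPoly (Fin m) K) (detPoly_isHomogeneous (n := Fin m) (k := K)))

/-- **GCT I, Thm. 4.7 for every algebraically closed field, from Kempf's parabolic criterion.**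
[cite: MulmuleySohoniSIAM2001, Thm. 4.7 (AV p.15)] -/
theorem MS2001_thm_4_7_of_parabolic
    (hKempf : ∀ (K : Type) [Field K] [IsAlgClosed K] (N D : ℕ) (v : MvPolynomial (Fin N × Fin N) K),
      v.IsHomogeneous D → ¬ IsPolystable v →
      ∃ W : Submodule K (Fin N × Fin N → K), W ≠ ⊥ ∧ W ≠ ⊤ ∧
        ∀ γ : Matrix.SpecialLinearGroup (Fin N × Fin N) K,
          linSubst (Fin N × Fin N) K (γ : Matrix (Fin N × Fin N) (Fin N × Fin N) K) v = v →
          ∀ x ∈ W, (γ : Matrix (Fin N × Fin N) (Fin N × Fin N) K).mulVec x ∈ W) :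
    MS2001_thm_4_7 := by
  intro K _ _ n
  haveI : Infinite K := IsAlgClosed.instInfinite
  exact isPolystable_perPoly_of_parabolic n
    (hKempf K n (Fintype.card (Fin n)) (perPoly (Fin n) K) (perPoly_isHomogeneous (n := Fin n) (k := K)))

end Literature.Computability.AlgebraicComplexity

end
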